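import Summits.Ventures.CertifiedManyBodySolver.Downfold.EmeryZoneOrbitalContentWeight
import HarnessLib

/-!
# THE ORBITAL PARTITION OF THE HOLES OVER THE ZONE, V: the assembled bracket theorem

Venture CertifiedManyBodySolver, cell `pub/hubbard-downfold` (stage S1; INFLATION-RULES-3to1-B §B.81), seat hubbard-downfold-mod-4
(technique B, g33); namespace `Summit.Ventures.CertifiedManyBodySolver.Downfold.Emery`. Everything PROVED (0 sorry). WHAT THIS IS NOT: a
statement about any material; `U = 0` one-body kinematics of the σ model.

* `holeCells thr` — the fine cells on / beyond a row-threshold staircase; **`regroup`**: a fine-cell sum of a coarse-cell quantity equals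
  the checker's row/block sum (`sum_blocks`, `sum_rows6`, `cnt6_sixAt`); `sums_as_cellsums`;
* **`ZoneCert.zone_bounds_of_check`**: all seven kernel checks `= true` ⇒ for every `ε_F ∈ [e₁, e₂]`,
  `2·dLo/(384²·10⁵) ≤ n_d^h(ε_F) ≤ 2·dHi/(384²·10⁵)`, `2·pLo/(384²·10⁵) ≤ 2n_p^h(ε_F) ≤ 2·pHi/(384²·10⁵)`,
  `2·nLo/384² ≤ n^h(ε_F) ≤ 2·nHi/384²` (lower sums on certainly-hole half-open cells via `sum_cells_le_zoneLint`, upper sums on the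
  closed-cell cover of the hole set via `zoneLint_le_sum_cells`, per-cell weights by `cell_weight_lo/hi`).

Sources: [HybertsenSchluterChristensen1989, Eq. (1)]; [AndersenEtAl1995, §6]; Riemann sums / interval arithmetic [folklore] (Moore 1966).
-/

namespace Summit.Ventures.CertifiedManyBodySolver.Downfold.Emery

open Real Set MeasureTheory Finset
open scoped ENNReal

/-! ## §9 Regrouping the certificate sums and the assembled theorem -/

/-- `((range n).map f).getD i d = f i` for `i < n` (local helper). [folklore] -/
private theorem getD_range_map {α : Type*} (f : ℕ → α) (d : α) {n i : ℕ} (hi : i < n) : ((List.range n).map f).getD i d = f i := by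
  rw [List.getD_eq_getElem _ _ (by simpa using hi)]
  simp

/-- The fine cells `(i, j)`, `i, j < 384`, on or beyond a row-threshold staircase: `thr i ≤ j`. [folklore] -/
def holeCells (thr : List ℕ) : Finset (ℕ × ℕ) :=
  (Finset.range 384 ×ˢ Finset.range 384).filter (fun ij => thr.getD ij.1 0 ≤ ij.2)

/-- Membership in `holeCells`. [folklore] -/
theorem mem_holeCells {thr : List ℕ} {ij : ℕ × ℕ} : ij ∈ holeCells thr ↔ ij.1 < 384 ∧ ij.2 < 384 ∧ thr.getD ij.1 0 ≤ ij.2 := by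
  unfold holeCells
  simp only [Finset.mem_filter, Finset.mem_product, Finset.mem_range, and_assoc]

/-- **REGROUPING**: the fine-cell sum over `holeCells thr` of a coarse-cell quantity equals the checker's row/block sum. [folklore] -/
theorem regroup {thr : List ℕ} (hl : thr.length = 384) (w : ℕ → ℕ → ℤ) :
    ∑ ij ∈ holeCells thr, w (ij.1 / 6) (ij.2 / 6) = rowZ (fun I => rowZ fun J => gmul (cnt6 (sixAt thr I) J) (w I J)) := by
  unfold holeCells
  rw [Finset.sum_filter, Finset.sum_product]
  have step1 : ∀ i, ∑ j ∈ Finset.range 384, (if thr.getD i 0 ≤ j then w (i / 6) (j / 6) else 0) =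
      ∑ J ∈ Finset.range 64, (cnt (thr.getD i 0) J : ℤ) * w (i / 6) J := fun i => sum_blocks (thr.getD i 0) (w (i / 6))
  simp only [step1]
  rw [sum_rows6 (fun I t => ∑ J ∈ Finset.range 64, (cnt t J : ℤ) * w I J) (fun i => thr.getD i 0), rowZ_eq]
  refine Finset.sum_congr rfl fun I hI => ?_
  rw [Finset.mem_range] at hI
  rw [rowZ_eq]
  simp only [gmul_eq, cnt6_sixAt hl hI, Finset.sum_mul]
  rw [Finset.sum_comm]

attribute [irreducible] holeCells

namespace ZoneCert

variable {C : ZoneCert}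

/-- The six checker sums as sums over `holeCells` (cast to `ℝ`). [folklore] -/
theorem sums_as_cellsums (hjin : C.jin1.length = 384) (hjout : C.jout2.length = 384) :
    ((C.dLoS C.wtabLo : ℤ) : ℝ) = ∑ ij ∈ holeCells C.jout2, (((C.wtabLo.getD (ij.1 / 6) []).getD (ij.2 / 6) 0 : ℤ) : ℝ) ∧
    ((C.pLoS C.wtabHi : ℤ) : ℝ) = ∑ ij ∈ holeCells C.jout2, ((wW - (C.wtabHi.getD (ij.1 / 6) []).getD (ij.2 / 6) 0 : ℤ) : ℝ) ∧
    ((C.nLoS : ℤ) : ℝ) = ∑ _ij ∈ holeCells C.jout2, ((1 : ℤ) : ℝ) ∧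
    ((C.dHiS C.wtabHi : ℤ) : ℝ) = ∑ ij ∈ holeCells C.jin1, (((C.wtabHi.getD (ij.1 / 6) []).getD (ij.2 / 6) 0 : ℤ) : ℝ) ∧
    ((C.pHiS C.wtabLo : ℤ) : ℝ) = ∑ ij ∈ holeCells C.jin1, ((wW - (C.wtabLo.getD (ij.1 / 6) []).getD (ij.2 / 6) 0 : ℤ) : ℝ) ∧
    ((C.nHiS : ℤ) : ℝ) = ∑ _ij ∈ holeCells C.jin1, ((1 : ℤ) : ℝ) := by
  have h1 : C.dLoS C.wtabLo = ∑ ij ∈ holeCells C.jout2, (C.wtabLo.getD (ij.1 / 6) []).getD (ij.2 / 6) 0 := by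
    rw [regroup hjout (fun I J => (C.wtabLo.getD I []).getD J 0)]; rfl
  have h2 : C.pLoS C.wtabHi = ∑ ij ∈ holeCells C.jout2, (wW - (C.wtabHi.getD (ij.1 / 6) []).getD (ij.2 / 6) 0) := by
    rw [regroup hjout (fun I J => wW - (C.wtabHi.getD I []).getD J 0)]; rfl
  have h3 : C.nLoS = ∑ _ij ∈ holeCells C.jout2, (1 : ℤ) := by
    rw [regroup hjout (fun _ _ => 1)]; unfold nLoS; simp only [gmul_eq, mul_one]
  have h4 : C.dHiS C.wtabHi = ∑ ij ∈ holeCells C.jin1, (C.wtabHi.getD (ij.1 / 6) []).getD (ij.2 / 6) 0 := by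
    rw [regroup hjin (fun I J => (C.wtabHi.getD I []).getD J 0)]; rfl
  have h5 : C.pHiS C.wtabLo = ∑ ij ∈ holeCells C.jin1, (wW - (C.wtabLo.getD (ij.1 / 6) []).getD (ij.2 / 6) 0) := by
    rw [regroup hjin (fun I J => wW - (C.wtabLo.getD I []).getD J 0)]; rfl
  have h6 : C.nHiS = ∑ _ij ∈ holeCells C.jin1, (1 : ℤ) := by
    rw [regroup hjin (fun _ _ => 1)]; unfold nHiS; simp only [gmul_eq, mul_one]
  refine ⟨?_, ?_, ?_, ?_, ?_, ?_⟩
  · rw [h1, Int.cast_sum]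
  · rw [h2, Int.cast_sum]
  · rw [h3, Int.cast_sum]
  · rw [h4, Int.cast_sum]
  · rw [h5, Int.cast_sum]
  · rw [h6, Int.cast_sum]

/-- Arithmetic of the final step (lower): `L ≤ X` and `2/384²·(X/10⁵) ≤ V` give `2L/(384²·10⁵) ≤ V`. [folklore] -/
theorem final_lower {L X V : ℝ} (h1 : L ≤ X) (h2 : 2 / ((384 : ℕ) : ℝ) ^ 2 * (X / 100000) ≤ V) :
    2 * L / (384 ^ 2 * 100000) ≤ V := by
  have e : ((384 : ℕ) : ℝ) = 384 := by norm_num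
  rw [e] at h2
  have : 2 * L / (384 ^ 2 * 100000) ≤ 2 / (384 : ℝ) ^ 2 * (X / 100000) := by
    rw [div_le_iff₀ (by norm_num)]
    have : 2 / (384 : ℝ) ^ 2 * (X / 100000) * (384 ^ 2 * 100000) = 2 * X := by field_simp
    rw [this]; linarith
  exact this.trans h2

/-- Arithmetic of the final step (upper). [folklore] -/
theorem final_upper {U X V : ℝ} (h1 : X ≤ U) (h2 : V ≤ 2 / ((384 : ℕ) : ℝ) ^ 2 * (X / 100000)) :
    V ≤ 2 * U / (384 ^ 2 * 100000) := by
  have e : ((384 : ℕ) : ℝ) = 384 := by norm_num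
  rw [e] at h2
  refine h2.trans ?_
  rw [le_div_iff₀ (by norm_num)]
  have : 2 / (384 : ℝ) ^ 2 * (X / 100000) * (384 ^ 2 * 100000) = 2 * X := by field_simp
  rw [this]; linarith

/-- Arithmetic of the final step for counts (lower). [folklore] -/
theorem final_lower1 {L X V : ℝ} (h1 : L ≤ X) (h2 : 2 / ((384 : ℕ) : ℝ) ^ 2 * X ≤ V) : 2 * L / 384 ^ 2 ≤ V := by
  have e : ((384 : ℕ) : ℝ) = 384 := by norm_num
  rw [e] at h2
  have : 2 * L / 384 ^ 2 ≤ 2 / (384 : ℝ) ^ 2 * X := by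
    rw [div_le_iff₀ (by norm_num)]
    have : 2 / (384 : ℝ) ^ 2 * X * 384 ^ 2 = 2 * X := by field_simp
    rw [this]; linarith
  exact this.trans h2

/-- Arithmetic of the final step for counts (upper). [folklore] -/
theorem final_upper1 {U X V : ℝ} (h1 : X ≤ U) (h2 : V ≤ 2 / ((384 : ℕ) : ℝ) ^ 2 * X) : V ≤ 2 * U / 384 ^ 2 := by
  have e : ((384 : ℕ) : ℝ) = 384 := by norm_num
  rw [e] at h2
  refine h2.trans ?_
  rw [le_div_iff₀ (by norm_num)]
  have : 2 / (384 : ℝ) ^ 2 * X * 384 ^ 2 = 2 * X := by field_simp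
  rw [this]; linarith

/-- **THE ZONE-PARTITION BRACKET THEOREM.** If all seven kernel checks of a certificate pass, then for every Fermi energy `ε_F` in
the bracket `[e₁, e₂]` the Cu-d hole content, the O-p hole content and the hole count of the σ antibonding band are bracketed by the
certificate's integers: `2·dLo/(384²·10⁵) ≤ n_d^h(ε_F) ≤ 2·dHi/(384²·10⁵)`, `2·pLo/(384²·10⁵) ≤ 2n_p^h(ε_F) ≤ 2·pHi/(384²·10⁵)`,
`2·nLo/384² ≤ n^h(ε_F) ≤ 2·nHi/384²`. [folklore] -/
theorem zone_bounds_of_check (hP : C.paramOK = true) (hL : C.levelsOK = true) (hF : C.fineOK = true) (hS : C.shellsOK = true)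
    (hCo : C.coarseOK = true) (hLo : C.sumsLoOK = true) (hHi : C.sumsHiOK = true) {εF : ℝ} (hε1 : (C.e1 : ℝ) ≤ εF)
    (hε2 : εF ≤ C.e2) :
    2 * (C.dLo : ℝ) / (384 ^ 2 * 100000) ≤ dHole (C.Δ : ℝ) C.a C.b C.c εF ∧
    dHole (C.Δ : ℝ) C.a C.b C.c εF ≤ 2 * (C.dHi : ℝ) / (384 ^ 2 * 100000) ∧
    2 * (C.pLo : ℝ) / (384 ^ 2 * 100000) ≤ pHole (C.Δ : ℝ) C.a C.b C.c εF ∧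
    pHole (C.Δ : ℝ) C.a C.b C.c εF ≤ 2 * (C.pHi : ℝ) / (384 ^ 2 * 100000) ∧
    2 * (C.nLo : ℝ) / 384 ^ 2 ≤ nHole (C.Δ : ℝ) C.a C.b C.c εF ∧
    nHole (C.Δ : ℝ) C.a C.b C.c εF ≤ 2 * (C.nHi : ℝ) / 384 ^ 2 := by
  have H := cellHyps_of hP hL hS hCo
  simp only [paramOK, Bool.and_eq_true, decide_eq_true_eq] at hP
  obtain ⟨⟨⟨⟨⟨⟨⟨⟨⟨⟨hΔ, hc⟩, hcb⟩, ha⟩, hh⟩, he1⟩, he12⟩, hM⟩, hclen⟩, hjin⟩, hjout⟩ := hP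
  simp only [levelsOK, Bool.and_eq_true, List.all_eq_true, List.mem_range] at hL
  obtain ⟨⟨hl1, hl2⟩, -⟩ := hL
  simp only [fineOK, Bool.and_eq_true, Bool.or_eq_true, List.all_eq_true, List.mem_range, decide_eq_true_eq] at hF
  simp only [sumsLoOK, sumsHiOK, Bool.and_eq_true, decide_eq_true_eq] at hLo hHi
  obtain ⟨⟨⟨sdLo, spHi⟩, snLo⟩, snHi⟩ := hLo
  obtain ⟨sdHi, spLo⟩ := hHi
  obtain ⟨RdLo, RpLo, RnLo, RdHi, RpHi, RnHi⟩ := sums_as_cellsums hjin hjout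
  -- real forms of the claimed inequalities, then forget the integer sums
  have cdLo : ((C.dLo : ℤ) : ℝ) ≤ ∑ ij ∈ holeCells C.jout2, (((C.wtabLo.getD (ij.1 / 6) []).getD (ij.2 / 6) 0 : ℤ) : ℝ) := by
    rw [← RdLo]; exact Int.cast_le.mpr sdLo
  have cpLo : ((C.pLo : ℤ) : ℝ) ≤ ∑ ij ∈ holeCells C.jout2, ((wW - (C.wtabHi.getD (ij.1 / 6) []).getD (ij.2 / 6) 0 : ℤ) : ℝ) := by
    rw [← RpLo]; exact Int.cast_le.mpr spLo
  have cnLo : ((C.nLo : ℤ) : ℝ) ≤ ∑ _ij ∈ holeCells C.jout2, ((1 : ℤ) : ℝ) := by rw [← RnLo]; exact Int.cast_le.mpr snLo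
  have cdHi : ∑ ij ∈ holeCells C.jin1, (((C.wtabHi.getD (ij.1 / 6) []).getD (ij.2 / 6) 0 : ℤ) : ℝ) ≤ ((C.dHi : ℤ) : ℝ) := by
    rw [← RdHi]; exact Int.cast_le.mpr sdHi
  have cpHi : ∑ ij ∈ holeCells C.jin1, ((wW - (C.wtabLo.getD (ij.1 / 6) []).getD (ij.2 / 6) 0 : ℤ) : ℝ) ≤ ((C.pHi : ℤ) : ℝ) := by
    rw [← RpHi]; exact Int.cast_le.mpr spHi
  have cnHi : ∑ _ij ∈ holeCells C.jin1, ((1 : ℤ) : ℝ) ≤ ((C.nHi : ℤ) : ℝ) := by rw [← RnHi]; exact Int.cast_le.mpr snHi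
  clear sdLo spHi snLo snHi sdHi spLo RdLo RpLo RnLo RdHi RpHi RnHi
  have hΔr : (0 : ℝ) ≤ C.Δ := by exact_mod_cast hΔ
  have hcr : (0 : ℝ) ≤ C.c := by exact_mod_cast hc
  have hbr : (0 : ℝ) ≤ C.b := by exact_mod_cast (hc.trans hcb)
  have hεF0 : (0 : ℝ) ≤ εF := le_trans (by exact_mod_cast he1.le) hε1
  have hK : 0 < 384 := by norm_num
  have hW : ((wW : ℤ) : ℝ) = 100000 := by norm_num [wW]
  -- fine cell facts
  have FH : ∀ i j : ℕ, i < 384 → j < 384 → C.jout2.getD i 0 ≤ j → ∀ k ∈ cellIcc 384 (i, j),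
      (C.e2 : ℝ) < abEnergyK (C.Δ : ℝ) C.a C.b C.c k := by
    intro i j hi hj hjo k hk
    obtain ⟨-, hjo384, hout⟩ := hF i hi
    rcases hout with h384 | hout
    · omega
    exact fine_hole_cell hl2 hi hjo hj hout hk
  have FO : ∀ i j : ℕ, i < 384 → j < C.jin1.getD i 0 → ∀ k ∈ cellIcc 384 (i, j),
      abEnergyK (C.Δ : ℝ) C.a C.b C.c k < (C.e1 : ℝ) := by
    intro i j hi hj k hk
    obtain ⟨⟨hji384, hin⟩, -, -⟩ := hF i hi
    rcases hin with h0 | hin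
    · omega
    exact fine_occ_cell hl1 hΔ hc hi (by omega) hji384 hin hk
  have hsub : ∀ i j : ℕ, ∀ k, k ∈ cellIcc 384 (i, j) → k ∈ cellIcc 64 (i / 6, j / 6) := fun i j k hk =>
    cellIcc_sub_coarse (K := 64) (by norm_num : 0 < 6) (i, j) hk
  -- covering: a hole point of the quadrant lies in a possibly-hole fine cell
  have COV : ∀ k ∈ bzQuad, εF < abEnergyK (C.Δ : ℝ) C.a C.b C.c k → ∃ ij ∈ holeCells C.jin1, k ∈ cellIcc 384 ij := by
    rintro ⟨k1, k2⟩ ⟨⟨h10, h1π⟩, ⟨h20, h2π⟩⟩ hhole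
    obtain ⟨i, hi, hi1, hi2⟩ := exists_gridIndex hK h10 h1π
    obtain ⟨j, hj, hj1, hj2⟩ := exists_gridIndex hK h20 h2π
    have hk : ((k1, k2) : ℝ × ℝ) ∈ cellIcc 384 (i, j) := ⟨⟨hi1, hi2⟩, ⟨hj1, hj2⟩⟩
    refine ⟨(i, j), ?_, hk⟩
    rw [mem_holeCells]
    refine ⟨hi, hj, ?_⟩
    show C.jin1.getD i 0 ≤ j
    by_contra hlt
    have := FO i j hi (lt_of_not_ge hlt) _ hk
    linarith
  have hind : ∀ k, εF < abEnergyK (C.Δ : ℝ) C.a C.b C.c k → holeInd (C.Δ : ℝ) C.a C.b C.c εF k = 1 := fun k hk => by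
    unfold holeInd; rw [if_pos hk]
  have hind0 : ∀ k, ¬ εF < abEnergyK (C.Δ : ℝ) C.a C.b C.c k → holeInd (C.Δ : ℝ) C.a C.b C.c εF k = 0 := fun k hk => by
    unfold holeInd; rw [if_neg hk]
  -- table entry facts
  have WL : ∀ i j : ℕ, i < 384 → j < 384 → 0 ≤ (C.wtabLo.getD (i / 6) []).getD (j / 6) 0 ∧
      (C.wtabLo.getD (i / 6) []).getD (j / 6) 0 ≤ wW := by
    intro i j hi hj
    unfold wtabLo; simp only; rw [getD_range_map _ _ (by omega), getD_range_map _ _ (by omega)]; exact cellWlo_mem _ _ _ _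
  have WH : ∀ i j : ℕ, i < 384 → j < 384 → 0 ≤ (C.wtabHi.getD (i / 6) []).getD (j / 6) 0 ∧
      (C.wtabHi.getD (i / 6) []).getD (j / 6) 0 ≤ wW := by
    intro i j hi hj
    unfold wtabHi; simp only; rw [getD_range_map _ _ (by omega), getD_range_map _ _ (by omega)]; exact cellWhi_mem _ _ _ _
  have hSmem : ∀ ij ∈ holeCells C.jout2, ij.1 < 384 ∧ ij.2 < 384 := fun ij hij => by
    rw [mem_holeCells] at hij; exact ⟨hij.1, hij.2.1⟩
  have hTmem : ∀ ij ∈ holeCells C.jin1, ij.1 < 384 ∧ ij.2 < 384 := fun ij hij => by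
    rw [mem_holeCells] at hij; exact ⟨hij.1, hij.2.1⟩
  have SH : ∀ ij ∈ holeCells C.jout2, ∀ k ∈ cellIco 384 ij,
      εF < abEnergyK (C.Δ : ℝ) C.a C.b C.c k ∧ (C.e1 : ℝ) < abEnergyK (C.Δ : ℝ) C.a C.b C.c k := by
    intro ij hij k hk
    rw [mem_holeCells] at hij
    have := FH ij.1 ij.2 hij.1 hij.2.1 hij.2.2 k (cellIco_subset_cellIcc 384 ij hk)
    exact ⟨lt_of_le_of_lt hε2 this, lt_of_le_of_lt (hε1.trans hε2) this⟩
  refine ⟨?_, ?_, ?_, ?_, ?_, ?_⟩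
  · -- d lower
    have hmain := sum_cells_le_zoneLint hK (holeCells C.jout2)
      (fun ij => (((C.wtabLo.getD (ij.1 / 6) []).getD (ij.2 / 6) 0 : ℤ) : ℝ) / 100000)
      (fun k => holeInd (C.Δ : ℝ) C.a C.b C.c εF k * abWeightK (C.Δ : ℝ) C.a C.b C.c k) hSmem (by
        intro ij hij k hk
        obtain ⟨hh1, hh2⟩ := SH ij hij k hk
        obtain ⟨hi, hj⟩ := hSmem ij hij
        show _ ≤ holeInd (C.Δ : ℝ) C.a C.b C.c εF k * abWeightK (C.Δ : ℝ) C.a C.b C.c k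
        rw [hind k hh1, one_mul]
        exact cell_weight_lo H (by omega) (by omega) (hsub ij.1 ij.2 k (cellIco_subset_cellIcc 384 ij hk)) hh2 he1)
    have hreal := real_lower_of_sum_le hK (fun ij hij => by
        have h0 : (0 : ℝ) ≤ (((C.wtabLo.getD (ij.1 / 6) []).getD (ij.2 / 6) 0 : ℤ) : ℝ) := Int.cast_nonneg (WL ij.1 ij.2 (hSmem ij hij).1 (hSmem ij hij).2).1
        exact div_nonneg h0 (by norm_num))
      (zoneLint_ne_top fun k => (dIntegrand_mem hΔr hcr hbr hεF0 k).2) hmain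
    rw [← Finset.sum_div] at hreal
    exact final_lower cdLo hreal
  · -- d upper
    have hmain := zoneLint_le_sum_cells hK (holeCells C.jin1)
      (fun ij => (((C.wtabHi.getD (ij.1 / 6) []).getD (ij.2 / 6) 0 : ℤ) : ℝ) / 100000)
      (fun k => holeInd (C.Δ : ℝ) C.a C.b C.c εF k * abWeightK (C.Δ : ℝ) C.a C.b C.c k) (by
        intro k hkQ hpos
        have hhole : εF < abEnergyK (C.Δ : ℝ) C.a C.b C.c k := by
          by_contra hn
          have : holeInd (C.Δ : ℝ) C.a C.b C.c εF k * abWeightK (C.Δ : ℝ) C.a C.b C.c k = 0 := by rw [hind0 k hn, zero_mul]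
          linarith
        obtain ⟨ij, hij, hk⟩ := COV k hkQ hhole
        refine ⟨ij, hij, hk, ?_⟩
        obtain ⟨hi, hj⟩ := hTmem ij hij
        show holeInd (C.Δ : ℝ) C.a C.b C.c εF k * abWeightK (C.Δ : ℝ) C.a C.b C.c k ≤ _
        rw [hind k hhole, one_mul]
        exact cell_weight_hi H (by omega) (by omega) (hsub ij.1 ij.2 k hk) (lt_of_le_of_lt hε1 hhole) he1)
    have hreal := real_upper_of_le_sum hK (fun ij hij => by
        have h0 : (0 : ℝ) ≤ (((C.wtabHi.getD (ij.1 / 6) []).getD (ij.2 / 6) 0 : ℤ) : ℝ) := Int.cast_nonneg (WH ij.1 ij.2 (hTmem ij hij).1 (hTmem ij hij).2).1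
        exact div_nonneg h0 (by norm_num)) hmain
    rw [← Finset.sum_div] at hreal
    exact final_upper cdHi hreal
  · -- p lower
    have hmain := sum_cells_le_zoneLint hK (holeCells C.jout2)
      (fun ij => ((wW - (C.wtabHi.getD (ij.1 / 6) []).getD (ij.2 / 6) 0 : ℤ) : ℝ) / 100000)
      (fun k => holeInd (C.Δ : ℝ) C.a C.b C.c εF k * (1 - abWeightK (C.Δ : ℝ) C.a C.b C.c k)) hSmem (by
        intro ij hij k hk
        obtain ⟨hh1, hh2⟩ := SH ij hij k hk
        obtain ⟨hi, hj⟩ := hSmem ij hij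
        show _ ≤ holeInd (C.Δ : ℝ) C.a C.b C.c εF k * (1 - abWeightK (C.Δ : ℝ) C.a C.b C.c k)
        rw [hind k hh1, one_mul]
        have hw := cell_weight_hi H (by omega) (by omega) (hsub ij.1 ij.2 k (cellIco_subset_cellIcc 384 ij hk)) hh2 he1
        rw [Int.cast_sub, hW, sub_div, div_self (by norm_num : (100000 : ℝ) ≠ 0)]
        linarith)
    have hreal := real_lower_of_sum_le hK (fun ij hij => by
        have h0 : (((C.wtabHi.getD (ij.1 / 6) []).getD (ij.2 / 6) 0 : ℤ) : ℝ) ≤ ((wW : ℤ) : ℝ) := Int.cast_le.mpr (WH ij.1 ij.2 (hSmem ij hij).1 (hSmem ij hij).2).2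
        rw [Int.cast_sub]
        exact div_nonneg (sub_nonneg.2 h0) (by norm_num))
      (zoneLint_ne_top fun k => (pIntegrand_mem hΔr hcr hbr hεF0 k).2) hmain
    rw [← Finset.sum_div] at hreal
    exact final_lower cpLo hreal
  · -- p upper
    have hmain := zoneLint_le_sum_cells hK (holeCells C.jin1)
      (fun ij => ((wW - (C.wtabLo.getD (ij.1 / 6) []).getD (ij.2 / 6) 0 : ℤ) : ℝ) / 100000)
      (fun k => holeInd (C.Δ : ℝ) C.a C.b C.c εF k * (1 - abWeightK (C.Δ : ℝ) C.a C.b C.c k)) (by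
        intro k hkQ hpos
        have hhole : εF < abEnergyK (C.Δ : ℝ) C.a C.b C.c k := by
          by_contra hn
          have : holeInd (C.Δ : ℝ) C.a C.b C.c εF k * (1 - abWeightK (C.Δ : ℝ) C.a C.b C.c k) = 0 := by
            rw [hind0 k hn, zero_mul]
          linarith
        obtain ⟨ij, hij, hk⟩ := COV k hkQ hhole
        refine ⟨ij, hij, hk, ?_⟩
        obtain ⟨hi, hj⟩ := hTmem ij hij
        show holeInd (C.Δ : ℝ) C.a C.b C.c εF k * (1 - abWeightK (C.Δ : ℝ) C.a C.b C.c k) ≤ _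
        rw [hind k hhole, one_mul]
        have hw := cell_weight_lo H (by omega) (by omega) (hsub ij.1 ij.2 k hk) (lt_of_le_of_lt hε1 hhole) he1
        rw [Int.cast_sub, hW, sub_div, div_self (by norm_num : (100000 : ℝ) ≠ 0)]
        linarith)
    have hreal := real_upper_of_le_sum hK (fun ij hij => by
        have h0 : (((C.wtabLo.getD (ij.1 / 6) []).getD (ij.2 / 6) 0 : ℤ) : ℝ) ≤ ((wW : ℤ) : ℝ) := Int.cast_le.mpr (WL ij.1 ij.2 (hTmem ij hij).1 (hTmem ij hij).2).2
        rw [Int.cast_sub]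
        exact div_nonneg (sub_nonneg.2 h0) (by norm_num)) hmain
    rw [← Finset.sum_div] at hreal
    exact final_upper cpHi hreal
  · -- n lower
    have hmain := sum_cells_le_zoneLint hK (holeCells C.jout2) (fun _ => ((1 : ℤ) : ℝ))
      (fun k => holeInd (C.Δ : ℝ) C.a C.b C.c εF k) hSmem (by
        intro ij hij k hk
        obtain ⟨hh1, -⟩ := SH ij hij k hk
        show ((1 : ℤ) : ℝ) ≤ holeInd (C.Δ : ℝ) C.a C.b C.c εF k
        rw [hind k hh1, Int.cast_one])
    have hreal := real_lower_of_sum_le hK (fun ij _ => by rw [Int.cast_one]; exact zero_le_one)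
      (zoneLint_ne_top fun k => holeInd_le_one _ _ _ _ _ k) hmain
    exact final_lower1 cnLo hreal
  · -- n upper
    have hmain := zoneLint_le_sum_cells hK (holeCells C.jin1) (fun _ => ((1 : ℤ) : ℝ))
      (fun k => holeInd (C.Δ : ℝ) C.a C.b C.c εF k) (by
        intro k hkQ hpos
        have hhole : εF < abEnergyK (C.Δ : ℝ) C.a C.b C.c k := by
          by_contra hn
          have : holeInd (C.Δ : ℝ) C.a C.b C.c εF k = 0 := hind0 k hn
          linarith
        obtain ⟨ij, hij, hk⟩ := COV k hkQ hhole
        refine ⟨ij, hij, hk, ?_⟩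
        show holeInd (C.Δ : ℝ) C.a C.b C.c εF k ≤ ((1 : ℤ) : ℝ)
        rw [Int.cast_one]; exact holeInd_le_one _ _ _ _ _ k)
    have hreal := real_upper_of_le_sum hK (fun ij _ => by rw [Int.cast_one]; exact zero_le_one) hmain
    exact final_upper1 cnHi hreal

end ZoneCert

end Summit.Ventures.CertifiedManyBodySolver.Downfold.Emery
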